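import Literature.NumberTheory.LFunctions.DirichletLFunctionZeroFreeRegion
import HarnessLib

/-!
# `L'/L(s, χ)` near `σ = 1`, away from the exceptional zeros (crude form of MV Theorem 11.4)

Topic `Literature/NumberTheory/LFunctions`. Everything in this file is PROVED (theorems only).

Montgomery–Vaughan, *Multiplicative Number Theory I*, Theorem 11.4, (11.5)/(11.8): for a
non-principal character `χ` mod `q` and `σ ≥ 1 − c/(2 log qτ)`,
`L'/L(s, χ) = [1/(s − β₁)] + O(log qτ)`, the bracket present only near an exceptional zero `β₁`.
For the Siegel–Walfisz theorem a *polynomial* bound in `log qτ` suffices, and we prove the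
following crude version, which needs neither "at most one exceptional zero" nor the comparison
`|s − ρ| ≍ |s₁ − ρ|` of MV (11.12)–(11.13):

* `exists_norm_logDeriv_le_of_re_ge` — there are absolute `c > 0`, `C ≥ 0` such that for
  `χ ≠ χ₀` mod `q`, `s = σ + it` with `σ ≥ 1 − c/ℒ` (`ℒ = log q + log(|t| + 4)`), and `0 < d ≤ 1`
  such that `|s − a| ≥ d` for every **real** zero `a > 1 − 2c/(log q + log 4)` of `L(s, χ)`:
  `‖L'/L(s, χ)‖ ≤ C ℒ³ / d`.

Proof (MV p. 278, simplified): by Lemma 11.1 (`Literature.NumberTheory.LFunctions.DirichletZFR.exists_logDeriv_package`)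
`L'/L(s) = ψ(s) + ∑_{a ∈ S} m(a)/(s − a)` with `|ψ| ≤ Eℒ`; at `s₁ = 1 + 1/(8ℒ) + it` the same
formula and `|L'/L(s₁)| ≤ 8ℒ + K₀` give `Re ∑ m(a)/(s₁ − a) ≤ (8 + K₀ + E)ℒ` (MV (11.11)), whence the
total multiplicity `∑ m(a) ≤ 8(8 + K₀ + E)ℒ²` (each `Re 1/(s₁ − a) ≥ σ₁ − 1`); finally every `a ∈ S`
is at distance `≥ c/ℒ` from `s` if `Re a ≤ 1 − 2c/ℒ`, and otherwise is real by the zero-free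
region (`Literature.NumberTheory.LFunctions.DirichletZFR.exists_zeroFree`, MV Theorem 11.3), hence at distance `≥ d`.

## References

* H. L. Montgomery, R. C. Vaughan, *Multiplicative Number Theory I. Classical Theory*, Cambridge
  Stud. Adv. Math. 97 (2007), §11.1, Theorem 11.4 (proof, p. 278, (11.11)–(11.13))
  (`MontgomeryVaughan2007`).
-/

noncomputable section

open Complex Filter Topology Metric Set Finset
open scoped LSeries.notation ArithmeticFunction.vonMangoldt

namespace Literature.NumberTheory.LFunctions.DirichletZFR

/-- `Re (1/z) ≥ Re z` when `‖z‖ ≤ 1` and `Re z ≥ 0` (`Re (1/z) = Re z/‖z‖²`). [folklore] -/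
theorem re_le_re_inv {z : ℂ} (hz : ‖z‖ ≤ 1) (hre : 0 ≤ z.re) : z.re ≤ (z⁻¹).re := by
  rcases eq_or_ne z 0 with rfl | hz0
  · simp
  rw [Complex.inv_re, Complex.normSq_eq_norm_sq]
  have hpos : 0 < ‖z‖ ^ 2 := by positivity
  rw [le_div_iff₀ hpos]
  have h1 : ‖z‖ ^ 2 ≤ 1 := pow_le_one₀ (norm_nonneg _) hz
  nlinarith

/-- **Total multiplicity of the zeros in the Lemma-α disc** (MV (11.11)): with the package of
MV Lemma 11.1 at height `t` and `s₁ = 1 + 1/(8ℒ) + it`, `ℒ = log q + log(|t| + 4)`,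
`∑_{a ∈ S} m(a) ≤ 8 (8 + K₀ + E) ℒ²`, because `Re ∑ m(a)/(s₁ − a) = Re L'/L(s₁) − Re ψ(s₁) ≤
(8ℒ + K₀) + Eℒ` and `Re 1/(s₁ − a) ≥ σ₁ − 1 = 1/(8ℒ)` for `|s₁ − a| ≤ 1`.
[cite: MontgomeryVaughan2007, Theorem 11.4 (proof, eq. (11.11))] -/
theorem sum_mult_le {q : ℕ} [NeZero q] (χ : DirichletCharacter ℂ q) (hχ : χ ≠ 1) {K₀ E : ℝ}
    (hK₀ : 0 ≤ K₀)
    (hKχ : ∀ (q : ℕ) [NeZero q] (χ : DirichletCharacter ℂ q) (s : ℂ), 1 < s.re →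
        ‖deriv χ.LFunction s / χ.LFunction s‖ ≤ 1 / (min s.re 2 - 1) + K₀)
    {t : ℝ} {S : Finset ℂ} {m : ℂ → ℕ} {ψ : ℂ → ℂ}
    (hS : ∀ a ∈ S, χ.LFunction a = 0 ∧ 0 < m a ∧ ‖a - (17 / 16 + t * I)‖ ≤ 13 / 32)
    (hψ : ∀ z ∈ ball (17 / 16 + t * I) (13 / 32), χ.LFunction z ≠ 0 →
          ψ z = deriv χ.LFunction z / χ.LFunction z - ∑ a ∈ S, (m a : ℂ) / (z - a))
    (hψb : ∀ z ∈ closedBall (17 / 16 + t * I) (13 / 128),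
          ‖ψ z‖ ≤ E * (Real.log q + Real.log (|t| + 4))) :
    (∑ a ∈ S, (m a : ℝ)) ≤ 8 * (8 + K₀ + E) * (Real.log q + Real.log (|t| + 4)) ^ 2 := by
  set ℒ : ℝ := Real.log q + Real.log (|t| + 4) with hℒ
  have hℒ1 : 1 ≤ ℒ := one_le_ell q t
  have hℒ0 : 0 < ℒ := by linarith
  set σ₁ : ℝ := 1 + 1 / (8 * ℒ) with hσ₁
  have hκ : 0 < 1 / (8 * ℒ) := by positivity
  have hκ1 : 1 / (8 * ℒ) ≤ 1 / 8 := by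
    rw [div_le_div_iff₀ (by positivity) (by norm_num)]; linarith
  obtain ⟨s₁, hs₁⟩ : ∃ s₁ : ℂ, s₁ = (σ₁ : ℂ) + t * I := ⟨_, rfl⟩
  have hs₁re : s₁.re = σ₁ := by simp [hs₁]
  have hs₁1 : 1 < s₁.re := by rw [hs₁re, hσ₁]; linarith
  set c : ℂ := 17 / 16 + t * I with hcdef
  have hs₁c : ‖s₁ - c‖ ≤ 13 / 128 := by
    have : s₁ - c = ((1 / (8 * ℒ) - 1 / 16 : ℝ) : ℂ) := by
      simp only [hs₁, hcdef, hσ₁]; push_cast; ring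
    rw [this, Complex.norm_real, Real.norm_eq_abs, abs_le]
    constructor <;> linarith
  have hs₁ball : s₁ ∈ ball c (13 / 32) := mem_ball_iff_norm.2 (by linarith)
  have hs₁cl : s₁ ∈ closedBall c (13 / 128) := mem_closedBall_iff_norm.2 hs₁c
  have hL₁ : χ.LFunction s₁ ≠ 0 :=
    DirichletCharacter.LFunction_ne_zero_of_one_le_re χ (Or.inl hχ) hs₁1.le
  have hψ₁ := hψ s₁ hs₁ball hL₁
  -- `Re ∑ ≤ (8 + K₀ + E) ℒ`
  have hbound : (∑ a ∈ S, (m a : ℂ) / (s₁ - a)).re ≤ (8 + K₀ + E) * ℒ := by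
    have hEq : ∑ a ∈ S, (m a : ℂ) / (s₁ - a) = deriv χ.LFunction s₁ / χ.LFunction s₁ - ψ s₁ := by
      rw [hψ₁]; ring
    rw [hEq, Complex.sub_re]
    have h1 : ‖deriv χ.LFunction s₁ / χ.LFunction s₁‖ ≤ 8 * ℒ + K₀ := by
      have := hKχ q χ s₁ hs₁1
      have hmin : min s₁.re 2 = σ₁ := by rw [hs₁re]; exact min_eq_left (by rw [hσ₁]; linarith)
      rw [hmin, hσ₁, show 1 + 1 / (8 * ℒ) - 1 = 1 / (8 * ℒ) by ring, one_div_one_div] at this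
      exact this
    have h2 := hψb s₁ hs₁cl
    have h3 := Complex.abs_re_le_norm (deriv χ.LFunction s₁ / χ.LFunction s₁)
    have h4 := Complex.abs_re_le_norm (ψ s₁)
    have hK₀ℒ : K₀ ≤ K₀ * ℒ := by nlinarith
    rw [abs_le] at h3 h4
    nlinarith [h3.2, h4.1]
  -- each term: `m(a) (σ₁ − 1) ≤ Re (m(a)/(s₁ − a))`
  have hterm : ∀ a ∈ S, (m a : ℝ) * (1 / (8 * ℒ)) ≤ ((m a : ℂ) / (s₁ - a)).re := by
    intro a ha
    obtain ⟨hLa, -, hac⟩ := hS a ha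
    have hare : a.re < 1 := by
      by_contra hcon
      exact DirichletCharacter.LFunction_ne_zero_of_one_le_re χ (Or.inl hχ) (not_lt.1 hcon) hLa
    have hn : ‖s₁ - a‖ ≤ 1 := by
      calc ‖s₁ - a‖ = ‖(s₁ - c) + (c - a)‖ := by ring_nf
        _ ≤ ‖s₁ - c‖ + ‖c - a‖ := norm_add_le _ _
        _ ≤ 13 / 128 + 13 / 32 := by rw [norm_sub_rev c a]; exact add_le_add hs₁c hac
        _ ≤ 1 := by norm_num
    have hre0 : 1 / (8 * ℒ) ≤ (s₁ - a).re := by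
      simp only [Complex.sub_re, hs₁re, hσ₁]; linarith
    have hinv := re_le_re_inv hn (by linarith)
    have hre : ((m a : ℂ) / (s₁ - a)).re = (m a : ℝ) * ((s₁ - a)⁻¹).re := by
      rw [div_eq_mul_inv, show ((m a : ℕ) : ℂ) = ((m a : ℝ) : ℂ) by simp, Complex.re_ofReal_mul]
    rw [hre]
    exact mul_le_mul_of_nonneg_left (hre0.trans hinv) (Nat.cast_nonneg _)
  have hsum : (∑ a ∈ S, (m a : ℝ)) * (1 / (8 * ℒ)) ≤ (8 + K₀ + E) * ℒ := by
    rw [Finset.sum_mul]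
    refine le_trans ?_ hbound
    rw [Complex.re_sum]
    exact Finset.sum_le_sum hterm
  rw [mul_one_div, div_le_iff₀ (by positivity)] at hsum
  have : (8 + K₀ + E) * ℒ * (8 * ℒ) = 8 * (8 + K₀ + E) * ℒ ^ 2 := by ring
  linarith

set_option maxHeartbeats 1600000 in
/-- **`L'/L(s, χ) ≪_q log(|t|+4)` near `σ = 1`, away from the exceptional zeros** (crude form
of MV Theorem 11.4, (11.5)/(11.8)): there are absolute constants `c > 0`, `C ≥ 0` such that for
every `q`, every non-principal `χ` mod `q`, every `s = σ + it` with
`σ ≥ 1 − c/(log q + log(|t| + 4))` and every `0 < d ≤ 1` with `|s − a| ≥ d` for all real zeros `a`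
of `L(s, χ)` with `a > 1 − 2c/(log q + log 4)`, one has `L(s, χ) ≠ 0` and
`‖L'/L(s, χ)‖ ≤ C ((log q + log 4)³ / d) · log(|t| + 4)`.
Proof (MV p. 278): with the Lemma-α package at height `t` and `s₁ = 1 + 1/(8ℒ) + it`,
`∑_a m(a)/(s−a) = ∑_a m(a)(1/(s−a) − 1/(s₁−a)) + ∑_a m(a)/(s₁−a)`; the last sum is
`L'/L(s₁) − ψ(s₁) = O(ℒ)` (MV (11.11)); for the zeros with `Re a ≤ 1 − 2c/ℒ` the difference is
`≪ Re 1/(s₁ − a)` (`Literature.NumberTheory.LFunctions.ClassicalZFRData.norm_inv_sub_inv_le`, MV (11.12)–(11.13)), of total `O(ℒ)`;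
the remaining zeros are real by the zero-free region (MV Theorem 11.3), can only occur for
`|t| ≤ 13/32`, are at distance `≥ d` from `s` and `≤ 1/(8ℒ)`… from `s₁`, and have total
multiplicity `≪ (log q + log 4)²` (`sum_mult_le`). The proof is a single long assembly and is
elaborated with a raised heartbeat limit. [cite: MontgomeryVaughan2007, Theorem 11.4] -/
theorem exists_norm_logDeriv_le_of_re_ge :
    ∃ c : ℝ, 0 < c ∧ ∃ C : ℝ, 0 ≤ C ∧
      (∀ (q : ℕ) [NeZero q] (χ : DirichletCharacter ℂ q), χ ≠ 1 → ∀ ρ : ℂ, χ.LFunction ρ = 0 →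
        1 - 2 * c / (Real.log q + Real.log (|ρ.im| + 4)) < ρ.re → χ ^ 2 = 1 ∧ ρ.im = 0) ∧
      ∀ (q : ℕ) [NeZero q] (χ : DirichletCharacter ℂ q), χ ≠ 1 →
      ∀ (s : ℂ) (d : ℝ), 0 < d → d ≤ 1 →
        1 - c / (Real.log q + Real.log (|s.im| + 4)) ≤ s.re →
        (∀ a : ℂ, χ.LFunction a = 0 → a.im = 0 →
          1 - 2 * c / (Real.log q + Real.log 4) < a.re → d ≤ ‖s - a‖) →
        χ.LFunction s ≠ 0 ∧
          ‖deriv χ.LFunction s / χ.LFunction s‖ ≤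
            C * ((Real.log q + Real.log 4) ^ 3 / d) * Real.log (|s.im| + 4) := by
  obtain ⟨c₀, hc₀, hzf⟩ := exists_zeroFree
  obtain ⟨K₀, hK₀, hK, hKχ⟩ := exists_norm_logDeriv_le
  obtain ⟨E, hE, hpackage⟩ := exists_logDeriv_package
  -- constants
  set c : ℝ := min (c₀ / 4) (1 / 40) with hcdef
  have hc4 : c ≤ c₀ / 4 := min_le_left _ _
  have hc40 : c ≤ 1 / 40 := min_le_right _ _
  have hcpos : 0 < c := lt_min (by positivity) (by norm_num)
  clear_value c
  -- the zero-free region at the constant `2c ≤ c₀/2`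
  have hzf2 : ∀ (q : ℕ) [NeZero q] (χ : DirichletCharacter ℂ q), χ ≠ 1 → ∀ ρ : ℂ,
      χ.LFunction ρ = 0 → 1 - 2 * c / (Real.log q + Real.log (|ρ.im| + 4)) < ρ.re →
      χ ^ 2 = 1 ∧ ρ.im = 0 := by
    intro q _ χ hχ ρ hρ hre
    refine hzf q χ hχ ρ hρ (lt_of_le_of_lt ?_ hre)
    have hℒ := ell_pos q ρ.im
    have : 2 * c / (Real.log q + Real.log (|ρ.im| + 4)) ≤ c₀ / (Real.log q + Real.log (|ρ.im| + 4)) :=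
      div_le_div_of_nonneg_right (by linarith) hℒ.le
    linarith
  set U : ℝ := 8 + K₀ + E with hU
  have hU0 : 0 ≤ U := by rw [hU]; positivity
  clear_value U
  set Kc : ℝ := 2 * (1 / (8 * c) + 2) with hKc
  have hKc0 : 0 ≤ Kc := by rw [hKc]; positivity
  clear_value Kc
  have hKcU : 0 ≤ Kc * U := mul_nonneg hKc0 hU0
  set C : ℝ := (E + U + Kc * U + 8 + K₀) + 13 * U * 11 + 1 with hCdef
  have hCpos : 0 ≤ C := by rw [hCdef]; positivity
  clear_value C
  refine ⟨c, hcpos, C, hCpos, hzf2, fun q _ χ hχ s d hd hd1 hregion hexc ↦ ?_⟩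
  clear hzf2
  obtain ⟨σ, hσdef⟩ : ∃ σ : ℝ, s.re = σ := ⟨_, rfl⟩
  obtain ⟨t, htdef⟩ : ∃ t : ℝ, s.im = t := ⟨_, rfl⟩
  have hs : s = σ + t * I := by
    rw [← hσdef, ← htdef]; exact (Complex.re_add_im s).symm.trans (by simp [mul_comm])
  rw [hσdef, htdef] at hregion
  rw [htdef]
  have hlogq : 0 ≤ Real.log q := Real.log_natCast_nonneg q
  have hlog4 : 1 ≤ Real.log 4 := by
    have := ClassicalZFRData.one_le_log_tau 0
    rwa [abs_zero, zero_add] at this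
  have hlogτ : 1 ≤ Real.log (|t| + 4) := ClassicalZFRData.one_le_log_tau t
  have hlog4τ : Real.log 4 ≤ Real.log (|t| + 4) :=
    Real.log_le_log (by norm_num) (by linarith [abs_nonneg t])
  have hell5 : |t| ≤ 13 / 32 → Real.log q + Real.log (|t| + 4) ≤
      5 / 4 * (Real.log q + Real.log 4) := fun ht ↦ by
    have := ell_le_of_abs_le q (t := 0) (t' := t) (by rw [abs_zero]; linarith)
    rwa [abs_zero, zero_add] at this
  set ℒ : ℝ := Real.log q + Real.log (|t| + 4) with hℒ
  set ℒ₀ : ℝ := Real.log q + Real.log 4 with hℒ₀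
  have hℒ1 : 1 ≤ ℒ := one_le_ell q t
  have hℒ0 : 0 < ℒ := by linarith
  have hℒ₀1 : 1 ≤ ℒ₀ := by rw [hℒ₀]; linarith
  have hℒ₀0 : 0 < ℒ₀ := by linarith
  have hℒ₀ℒ : ℒ₀ ≤ ℒ := by rw [hℒ₀, hℒ]; linarith
  have hℒprod : ℒ ≤ ℒ₀ * Real.log (|t| + 4) := by
    rw [hℒ, hℒ₀, add_mul]; nlinarith
  clear_value ℒ ℒ₀
  have hcℒ : c / ℒ ≤ c := div_le_self hcpos.le hℒ1
  -- every zero `a` of `L(·, χ)` with `Re a > 1 − 2c/ℒ` and `|Im a| ≤ |t| + 1` is real and far from `s`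
  have hreal : ∀ a : ℂ, χ.LFunction a = 0 → |a.im| ≤ |t| + 1 → 1 - 2 * c / ℒ < a.re →
      a.im = 0 ∧ d ≤ ‖s - a‖ := by
    intro a hLa haim hare
    have hℒa := ell_le_of_abs_le q haim
    have hℒa0 : 0 < Real.log q + Real.log (|a.im| + 4) := ell_pos q a.im
    have h1 : c₀ / ℒ * (4 / 5) ≤ c₀ / (Real.log q + Real.log (|a.im| + 4)) := by
      rw [div_mul_eq_mul_div, div_le_div_iff₀ (by positivity) hℒa0]
      nlinarith
    have h2 : 2 * c / ℒ ≤ c₀ / ℒ * (4 / 5) := by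
      rw [div_mul_eq_mul_div, div_le_div_iff₀ hℒ0 (by positivity)]
      have : 2 * c ≤ c₀ * 4 / 5 := by linarith
      nlinarith
    have hzone : 1 - c₀ / (Real.log q + Real.log (|a.im| + 4)) < a.re := by linarith
    obtain ⟨-, him⟩ := hzf q χ hχ a hLa hzone
    have h3 : 2 * c / ℒ ≤ 2 * c / ℒ₀ :=
      div_le_div_of_nonneg_left (by positivity) hℒ₀0 hℒ₀ℒ
    exact ⟨him, hexc a hLa him (by linarith)⟩
  -- `L(s, χ) ≠ 0`
  have hLs : χ.LFunction s ≠ 0 := by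
    intro hLs
    have him : |s.im| ≤ |t| + 1 := by rw [htdef]; linarith
    have hre : 1 - 2 * c / ℒ < s.re := by
      have h1 : 0 < c / ℒ := by positivity
      have h2 : 2 * c / ℒ = 2 * (c / ℒ) := by ring
      rw [hσdef]; linarith
    obtain ⟨-, hds⟩ := hreal _ hLs him hre
    rw [sub_self, norm_zero] at hds
    linarith
  refine ⟨hLs, ?_⟩
  have hℒ₀3 : ℒ₀ ≤ ℒ₀ ^ 3 / d := by
    rw [le_div_iff₀ hd]
    calc ℒ₀ * d ≤ ℒ₀ * 1 := mul_le_mul_of_nonneg_left hd1 hℒ₀0.le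
      _ ≤ ℒ₀ ^ 3 := by nlinarith [one_le_pow₀ (n := 2) hℒ₀1]
  have hℒ₀3' : 1 ≤ ℒ₀ ^ 3 / d := hℒ₀1.trans hℒ₀3
  -- the easy case `σ ≥ σ₁ = 1 + 1/(8ℒ)`: `‖L'/L‖ ≤ 8ℒ + K₀`
  have hκ : 0 < 1 / (8 * ℒ) := by positivity
  have hκ1 : 1 / (8 * ℒ) ≤ 1 / 8 := by
    rw [div_le_div_iff₀ (by positivity) (by norm_num)]; linarith
  set σ₁ : ℝ := 1 + 1 / (8 * ℒ) with hσ₁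
  have hσ₁1 : 1 < σ₁ := by rw [hσ₁]; linarith
  have hσ₁2 : σ₁ ≤ 1 + 1 / 8 := by rw [hσ₁]; linarith
  clear_value σ₁
  have hℒ₀3d : 0 ≤ ℒ₀ ^ 3 / d := div_nonneg (pow_nonneg hℒ₀0.le 3) hd.le
  -- a bound `B ℒ ≤ B ℒ₀³/d · log(|t|+4)` for non-negative `B`
  have hscale : ∀ B : ℝ, 0 ≤ B → B * ℒ ≤ B * (ℒ₀ ^ 3 / d) * Real.log (|t| + 4) := by
    intro B hB
    calc B * ℒ ≤ B * (ℒ₀ * Real.log (|t| + 4)) := mul_le_mul_of_nonneg_left hℒprod hB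
      _ ≤ B * (ℒ₀ ^ 3 / d * Real.log (|t| + 4)) :=
          mul_le_mul_of_nonneg_left (mul_le_mul_of_nonneg_right hℒ₀3 (by linarith only [hlogτ])) hB
      _ = B * (ℒ₀ ^ 3 / d) * Real.log (|t| + 4) := by ring
  have hK₀ℒ : K₀ ≤ K₀ * ℒ := by nlinarith
  rcases le_or_gt σ₁ σ with hbig | hsmallσ
  · have h3 : 1 / (min σ 2 - 1) ≤ 8 * ℒ := by
      have hmin : 1 / (8 * ℒ) ≤ min σ 2 - 1 := by
        rw [le_sub_iff_add_le]
        exact le_min (by rw [hσ₁] at hbig; linarith) (by linarith)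
      calc 1 / (min σ 2 - 1) ≤ 1 / (1 / (8 * ℒ)) := one_div_le_one_div_of_le hκ hmin
        _ = 8 * ℒ := one_div_one_div _
    have hbound : 1 / (min σ 2 - 1) + K₀ ≤ C * (ℒ₀ ^ 3 / d) * Real.log (|t| + 4) := by
      have h4 : 1 / (min σ 2 - 1) + K₀ ≤ (8 + K₀) * ℒ := by linarith
      have h5 := hscale (8 + K₀) (by positivity)
      have h6 : (8 + K₀) * (ℒ₀ ^ 3 / d) * Real.log (|t| + 4) ≤ C * (ℒ₀ ^ 3 / d) * Real.log (|t| + 4) := by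
        refine mul_le_mul_of_nonneg_right (mul_le_mul_of_nonneg_right ?_ hℒ₀3d) (by linarith)
        rw [hCdef]; linarith
      linarith
    have h1 : 1 < s.re := by rw [hσdef]; linarith
    have h2 := hKχ q χ _ h1
    rw [hσdef] at h2
    exact h2.trans hbound
  -- pure real-variable facts for the main case (proved before any analytic hypothesis
  -- enters the context)
  -- the constant `Kc` dominates `(w/κ)(w/d + 1)`
  have hKc_ge : (1 / (8 * ℒ) + c / ℒ) / (1 / (8 * ℒ)) * ((1 / (8 * ℒ) + c / ℒ) / (c / ℒ) + 1) ≤ Kc := by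
    have e1 : (1 / (8 * ℒ) + c / ℒ) / (1 / (8 * ℒ)) = 1 + 8 * c := by field_simp
    have e2 : (1 / (8 * ℒ) + c / ℒ) / (c / ℒ) = 1 / (8 * c) + 1 := by field_simp
    rw [e1, e2]
    have h1 : 1 + 8 * c ≤ 2 := by linarith only [hc40]
    have h0 : 0 ≤ 1 / (8 * c) + 1 + 1 := by positivity
    calc (1 + 8 * c) * (1 / (8 * c) + 1 + 1) ≤ 2 * (1 / (8 * c) + 1 + 1) :=
          mul_le_mul_of_nonneg_right h1 h0
      _ = Kc := by rw [hKc]; ring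
  have h2c : 2 * c / ℒ = 2 * (c / ℒ) := by ring
  -- light constants for the final assembly
  have hposA : 0 ≤ E + U + Kc * U := by linarith only [hE, hU0, hKcU]
  have hposd : 0 < 1 / d := by positivity
  have hX0 : 0 ≤ U * ℒ₀ ^ 2 * (1 / d + 10 * ℒ₀) := by positivity
  have hB : 13 * U * ℒ₀ ^ 2 * (1 / d + 10 * ℒ₀) ≤ (13 * U * 11) * (ℒ₀ ^ 3 / d) * Real.log (|t| + 4) := by
    have hd' : 1 ≤ 1 / d := by
      rw [le_div_iff₀ hd]; linarith only [hd1]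
    have h23 : (2 : ℕ) ≤ 3 := Nat.le_succ 2
    have hℒ₀sq : 0 ≤ ℒ₀ ^ 2 := sq_nonneg _
    have hℒ₀cube : ℒ₀ ^ 2 ≤ ℒ₀ ^ 3 := pow_le_pow_right₀ hℒ₀1 h23
    have hℒ₀3nn : 0 ≤ ℒ₀ ^ 3 := pow_nonneg hℒ₀0.le 3
    -- `ℒ₀²/d ≤ ℒ₀³/d` and `10 ℒ₀³ ≤ 10 ℒ₀³/d`
    have h2 : ℒ₀ ^ 2 * (1 / d) ≤ ℒ₀ ^ 3 * (1 / d) := mul_le_mul_of_nonneg_right hℒ₀cube hposd.le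
    have h3 : ℒ₀ ^ 3 * 1 ≤ ℒ₀ ^ 3 * (1 / d) := mul_le_mul_of_nonneg_left hd' hℒ₀3nn
    have h1 : ℒ₀ ^ 2 * (1 / d + 10 * ℒ₀) ≤ 11 * (ℒ₀ ^ 3 / d) := by
      have e1 : ℒ₀ ^ 2 * (1 / d + 10 * ℒ₀) = ℒ₀ ^ 2 * (1 / d) + 10 * (ℒ₀ ^ 3 * 1) := by ring
      have e2 : 11 * (ℒ₀ ^ 3 / d) = ℒ₀ ^ 3 * (1 / d) + 10 * (ℒ₀ ^ 3 * (1 / d)) := by ring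
      rw [e1, e2]
      linarith only [h2, h3]
    have h13U : 0 ≤ 13 * U := by linarith only [hU0]
    have h143U : 0 ≤ 13 * U * 11 := by linarith only [hU0]
    have h13U' : 0 ≤ (13 * U * 11) * (ℒ₀ ^ 3 / d) := mul_nonneg h143U hℒ₀3d
    have e3 : 13 * U * ℒ₀ ^ 2 * (1 / d + 10 * ℒ₀) = 13 * U * (ℒ₀ ^ 2 * (1 / d + 10 * ℒ₀)) := by ring
    have e4 : 13 * U * (11 * (ℒ₀ ^ 3 / d)) = (13 * U * 11) * (ℒ₀ ^ 3 / d) * 1 := by ring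
    have h5 : 13 * U * (ℒ₀ ^ 2 * (1 / d + 10 * ℒ₀)) ≤ 13 * U * (11 * (ℒ₀ ^ 3 / d)) :=
      mul_le_mul_of_nonneg_left h1 h13U
    have h6 : (13 * U * 11) * (ℒ₀ ^ 3 / d) * 1 ≤ (13 * U * 11) * (ℒ₀ ^ 3 / d) * Real.log (|t| + 4) :=
      mul_le_mul_of_nonneg_left hlogτ h13U'
    rw [e3]
    rw [e4] at h5
    exact h5.trans h6
  have hA := hscale (E + U + Kc * U) hposA
  have hC : (E + U + Kc * U) * (ℒ₀ ^ 3 / d) * Real.log (|t| + 4) +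
      (13 * U * 11) * (ℒ₀ ^ 3 / d) * Real.log (|t| + 4) ≤ C * (ℒ₀ ^ 3 / d) * Real.log (|t| + 4) := by
    rw [← add_mul, ← add_mul]
    have hlogτ0 : 0 ≤ Real.log (|t| + 4) := by linarith only [hlogτ]
    refine mul_le_mul_of_nonneg_right (mul_le_mul_of_nonneg_right ?_ hℒ₀3d) hlogτ0
    rw [hCdef]; linarith only [hK₀]
  have htarget : (E + U + Kc * U) * ℒ + 13 * U * ℒ₀ ^ 2 * (1 / d + 10 * ℒ₀) ≤
      C * (ℒ₀ ^ 3 / d) * Real.log (|t| + 4) := by linarith only [hA, hB, hC]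
  have hnearScale : |t| ≤ 13 / 32 →
      (8 * U * ℒ ^ 2) * (1 / d + 8 * ℒ) ≤ 13 * U * ℒ₀ ^ 2 * (1 / d + 10 * ℒ₀) := by
    intro ht
    have hℒℒ₀ : ℒ ≤ 5 / 4 * ℒ₀ := hell5 ht
    calc (8 * U * ℒ ^ 2) * (1 / d + 8 * ℒ)
        ≤ (8 * U * (5 / 4 * ℒ₀) ^ 2) * (1 / d + 8 * (5 / 4 * ℒ₀)) := by
          have h1 : ℒ ^ 2 ≤ (5 / 4 * ℒ₀) ^ 2 := pow_le_pow_left₀ hℒ0.le hℒℒ₀ 2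
          have h2 : 1 / d + 8 * ℒ ≤ 1 / d + 8 * (5 / 4 * ℒ₀) := by linarith only [hℒℒ₀]
          have h3 : 0 ≤ 1 / d + 8 * ℒ := by linarith only [hposd, hℒ0]
          have h4 : 0 ≤ 8 * U := by linarith only [hU0]
          have h5 : 0 ≤ 8 * U * (5 / 4 * ℒ₀) ^ 2 := mul_nonneg h4 (sq_nonneg _)
          exact mul_le_mul (mul_le_mul_of_nonneg_left h1 h4) h2 h3 h5
      _ = 25 / 2 * (U * ℒ₀ ^ 2 * (1 / d + 10 * ℒ₀)) := by ring
      _ ≤ 13 * U * ℒ₀ ^ 2 * (1 / d + 10 * ℒ₀) := by linarith only [hX0]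
  -- the main case `1 − c/ℒ ≤ σ < σ₁`: `s` and `s₁` lie in the small Lemma-α disc at height `t`
  obtain ⟨S, m, ψ, hS, hS', hψ, hψb⟩ := hpackage q χ hχ t
  -- total multiplicity of the zeros in the disc (MV (11.11))
  have hmult := sum_mult_le χ hχ hK₀ hKχ hS hψ hψb
  rw [← hℒ] at hmult
  obtain ⟨cc, hccdef⟩ : ∃ cc : ℂ, cc = 17 / 16 + t * I := ⟨_, rfl⟩
  rw [← hccdef] at hS hS' hψ hψb
  have hcc' : cc = ((17 / 16 : ℝ) : ℂ) + t * I := by rw [hccdef]; push_cast; ring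
  have hccim : cc.im = t := by rw [hcc']; simp
  have hσlow : 1 - 5 / 128 ≤ σ := by
    have h1 : c / ℒ ≤ 1 / 40 := hcℒ.trans hc40
    linarith only [h1, hregion]
  have hsc : ‖s - cc‖ ≤ 13 / 128 := by
    have : s - cc = ((σ - 17 / 16 : ℝ) : ℂ) := by rw [hs, hccdef]; push_cast; ring
    rw [this, Complex.norm_real, Real.norm_eq_abs]
    exact abs_le.2 ⟨by linarith only [hσlow], by linarith only [hsmallσ, hσ₁2]⟩
  have hsball : s ∈ ball cc (13 / 32) :=
    mem_ball_iff_norm.2 (by linarith only [hsc])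
  have hscl : s ∈ closedBall cc (13 / 128) := mem_closedBall_iff_norm.2 hsc
  have hψs := hψ _ hsball hLs
  -- the auxiliary point `s₁`
  obtain ⟨s₁, hs₁⟩ : ∃ s₁ : ℂ, s₁ = (σ₁ : ℂ) + t * I := ⟨_, rfl⟩
  have hs₁re : s₁.re = σ₁ := by simp [hs₁]
  have hs₁im : s₁.im = t := by simp [hs₁]
  have hs₁1 : 1 < s₁.re := by rw [hs₁re]; exact hσ₁1
  have hs₁c : ‖s₁ - cc‖ ≤ 13 / 128 := by
    have : s₁ - cc = ((σ₁ - 17 / 16 : ℝ) : ℂ) := by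
      simp only [hs₁, hccdef]; push_cast; ring
    rw [this, Complex.norm_real, Real.norm_eq_abs]
    exact abs_le.2 ⟨by linarith only [hσ₁1], by linarith only [hσ₁2]⟩
  have hs₁ball : s₁ ∈ ball cc (13 / 32) := mem_ball_iff_norm.2 (by linarith only [hs₁c])
  have hs₁cl : s₁ ∈ closedBall cc (13 / 128) := mem_closedBall_iff_norm.2 hs₁c
  have hL₁ : χ.LFunction s₁ ≠ 0 :=
    DirichletCharacter.LFunction_ne_zero_of_one_le_re χ (Or.inl hχ) hs₁1.le
  have hψ₁ := hψ s₁ hs₁ball hL₁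
  -- light facts about the zeros in `S`
  have hSre : ∀ a ∈ S, a.re < 1 := by
    intro a ha
    by_contra hcon
    exact DirichletCharacter.LFunction_ne_zero_of_one_le_re χ (Or.inl hχ) (not_lt.1 hcon) (hS a ha).1
  have hSre₁ : ∀ a ∈ S, 1 / (8 * ℒ) ≤ (s₁ - a).re := by
    intro a ha
    rw [Complex.sub_re, hs₁re, hσ₁]
    have := hSre a ha
    linarith only [this]
  have hSim : ∀ a ∈ S, |a.im| ≤ |t| + 1 ∧ |a.im - t| ≤ 13 / 32 := by
    intro a ha
    have h1 : |(a - cc).im| ≤ ‖a - cc‖ := Complex.abs_im_le_norm _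
    have h2 : (a - cc).im = a.im - t := by rw [Complex.sub_im, hccim]
    rw [h2] at h1
    have h3 := (hS a ha).2.2
    have h4 := abs_sub_abs_le_abs_sub a.im t
    have h5 : |a.im - t| ≤ 13 / 32 := h1.trans h3
    refine ⟨?_, h5⟩
    linarith only [h4, h5]
  -- the weighted real parts at `s₁` are non-negative
  have hterm_re : ∀ a ∈ S, ((m a : ℂ) / (s₁ - a)).re = (m a : ℝ) * ((s₁ - a)⁻¹).re := by
    intro a _
    rw [div_eq_mul_inv, show ((m a : ℕ) : ℂ) = ((m a : ℝ) : ℂ) by simp, Complex.re_ofReal_mul]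
  have hinv_nn : ∀ a ∈ S, 0 ≤ ((s₁ - a)⁻¹).re := by
    intro a ha
    rw [Complex.inv_re]
    exact div_nonneg (hκ.le.trans (hSre₁ a ha)) (Complex.normSq_nonneg _)
  have hterm_nn : ∀ a ∈ S, 0 ≤ (m a : ℝ) * ((s₁ - a)⁻¹).re := fun a ha ↦
    mul_nonneg (Nat.cast_nonneg _) (hinv_nn a ha)
  have hsumre_eq : (∑ a ∈ S, (m a : ℂ) / (s₁ - a)).re = ∑ a ∈ S, (m a : ℝ) * ((s₁ - a)⁻¹).re := by
    rw [Complex.re_sum]; exact Finset.sum_congr rfl hterm_re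
  -- split `S` into far and near zeros
  classical
  obtain ⟨Sfar, hSfar⟩ : ∃ Sfar : Finset ℂ, Sfar = S.filter (fun a ↦ a.re ≤ 1 - 2 * c / ℒ) :=
    ⟨_, rfl⟩
  obtain ⟨Snear, hSnear⟩ : ∃ Snear : Finset ℂ, Snear = S.filter (fun a ↦ ¬ a.re ≤ 1 - 2 * c / ℒ) :=
    ⟨_, rfl⟩
  -- (2) the far zeros: `‖1/(s−a) − 1/(s₁−a)‖ ≤ Kc · Re 1/(s₁ − a)`
  have hfar : ∀ a ∈ Sfar, ‖(s - a)⁻¹ - (s₁ - a)⁻¹‖ ≤ Kc * ((s₁ - a)⁻¹).re := by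
    intro a ha
    rw [hSfar, Finset.mem_filter] at ha
    obtain ⟨haS, hare⟩ := ha
    have hw : s₁.re - s.re ≤ 1 / (8 * ℒ) + c / ℒ := by
      rw [hs₁re, hσdef, hσ₁]; linarith only [hregion]
    have hdd : c / ℒ ≤ s.re - a.re := by
      rw [hσdef]; linarith only [hare, hregion, h2c]
    have hκκ : 1 / (8 * ℒ) ≤ s₁.re - a.re := by
      have := hSre₁ a haS; simpa only [Complex.sub_re] using this
    have hσσ₁ : s.re ≤ s₁.re := by rw [hσdef, hs₁re]; exact hsmallσ.le
    have h := ClassicalZFRData.norm_inv_sub_inv_le (s := s) (s₁ := s₁) (a := a)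
      (w := 1 / (8 * ℒ) + c / ℒ) (d := c / ℒ) (κ := 1 / (8 * ℒ)) (div_pos hcpos hℒ0) hκ
      (by rw [htdef, hs₁im]) hσσ₁ hw hdd hκκ
    exact h.trans (mul_le_mul_of_nonneg_right hKc_ge (hinv_nn a haS))
  -- (3) the near zeros are real, at distance `≥ d` from `s`, and force `|t| ≤ 13/32`
  have hnear : ∀ a ∈ Snear, a.im = 0 ∧ d ≤ ‖s - a‖ ∧ |t| ≤ 13 / 32 := by
    intro a ha
    rw [hSnear, Finset.mem_filter] at ha
    obtain ⟨haS, hare⟩ := ha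
    obtain ⟨him, hds⟩ := hreal a (hS a haS).1 (hSim a haS).1 (not_le.1 hare)
    refine ⟨him, hds, ?_⟩
    have := (hSim a haS).2
    rw [him, zero_sub, abs_neg] at this
    exact this
  have hnear_bd : ∀ a ∈ Snear, ‖(s - a)⁻¹ - (s₁ - a)⁻¹‖ ≤ 1 / d + 8 * ℒ := by
    intro a ha
    obtain ⟨-, hds, -⟩ := hnear a ha
    have haS : a ∈ S := (Finset.mem_filter.1 (by rw [hSnear] at ha; exact ha)).1
    have h1 : ‖(s - a)⁻¹‖ ≤ 1 / d := by
      rw [norm_inv, one_div]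
      exact inv_anti₀ hd hds
    have h2 : ‖(s₁ - a)⁻¹‖ ≤ 8 * ℒ := by
      rw [norm_inv]
      have hre : 1 / (8 * ℒ) ≤ ‖s₁ - a‖ := (hSre₁ a haS).trans (Complex.re_le_norm _)
      calc ‖s₁ - a‖⁻¹ ≤ (1 / (8 * ℒ))⁻¹ := inv_anti₀ hκ hre
        _ = 8 * ℒ := by rw [one_div, inv_inv]
    exact (norm_sub_le _ _).trans (add_le_add h1 h2)
  -- HEAVY PART: from here on only explicit estimates
  -- (1) `‖∑ m(a)/(s₁ − a)‖ ≤ Uℒ`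
  have hL'₁ : ‖deriv χ.LFunction s₁ / χ.LFunction s₁‖ ≤ 8 * ℒ + K₀ := by
    have := hKχ q χ s₁ hs₁1
    have hσ₁le2 : σ₁ ≤ 2 := by linarith only [hσ₁2]
    have hmin : min s₁.re 2 = σ₁ := by rw [hs₁re]; exact min_eq_left hσ₁le2
    rw [hmin, hσ₁, show 1 + 1 / (8 * ℒ) - 1 = 1 / (8 * ℒ) by ring, one_div_one_div] at this
    exact this
  have hsum₁eq : ∑ a ∈ S, (m a : ℂ) / (s₁ - a) = deriv χ.LFunction s₁ / χ.LFunction s₁ - ψ s₁ := by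
    rw [hψ₁]; ring
  have hsum₁ : ‖∑ a ∈ S, (m a : ℂ) / (s₁ - a)‖ ≤ U * ℒ := by
    rw [hsum₁eq]
    have h1 := norm_sub_le (deriv χ.LFunction s₁ / χ.LFunction s₁) (ψ s₁)
    have h2 := hψb s₁ hs₁cl
    rw [← hℒ] at h2
    have h3 : (8 * ℒ + K₀) + E * ℒ ≤ U * ℒ := by rw [hU]; linear_combination hK₀ℒ
    linarith only [h1, hL'₁, h2, h3]
  have hsum₁re : ∑ a ∈ S, (m a : ℝ) * ((s₁ - a)⁻¹).re ≤ U * ℒ := by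
    rw [← hsumre_eq]; exact (Complex.re_le_norm _).trans hsum₁
  -- (4) the near zeros, via the total multiplicity (needed only if there is a near zero)
  have hnear_sum : ∑ a ∈ Snear, (m a : ℝ) * ‖(s - a)⁻¹ - (s₁ - a)⁻¹‖ ≤
      13 * U * ℒ₀ ^ 2 * (1 / d + 10 * ℒ₀) := by
    by_cases hne : Snear = ∅
    · rw [hne, Finset.sum_empty]; linarith only [hX0]
    · obtain ⟨a₀, ha₀⟩ := Finset.nonempty_iff_ne_empty.2 hne
      obtain ⟨-, -, ht⟩ := hnear a₀ ha₀
      have hnd : 0 ≤ 1 / d + 8 * ℒ := by linarith only [hposd, hℒ0]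
      calc ∑ a ∈ Snear, (m a : ℝ) * ‖(s - a)⁻¹ - (s₁ - a)⁻¹‖
          ≤ ∑ a ∈ Snear, (m a : ℝ) * (1 / d + 8 * ℒ) :=
            Finset.sum_le_sum fun a ha ↦ mul_le_mul_of_nonneg_left (hnear_bd a ha) (Nat.cast_nonneg _)
        _ = (∑ a ∈ Snear, (m a : ℝ)) * (1 / d + 8 * ℒ) := (Finset.sum_mul _ _ _).symm
        _ ≤ (∑ a ∈ S, (m a : ℝ)) * (1 / d + 8 * ℒ) := by
            refine mul_le_mul_of_nonneg_right ?_ hnd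
            exact Finset.sum_le_sum_of_subset_of_nonneg (by rw [hSnear]; exact Finset.filter_subset _ _)
              (fun a _ _ ↦ Nat.cast_nonneg _)
        _ ≤ (8 * U * ℒ ^ 2) * (1 / d + 8 * ℒ) := by
            refine mul_le_mul_of_nonneg_right ?_ hnd
            rw [hU]; exact hmult
        _ ≤ 13 * U * ℒ₀ ^ 2 * (1 / d + 10 * ℒ₀) := hnearScale ht
  -- (5) the far sum: `≤ Kc · U ℒ`
  have hfar_sum : ∑ a ∈ Sfar, (m a : ℝ) * ‖(s - a)⁻¹ - (s₁ - a)⁻¹‖ ≤ Kc * (U * ℒ) := by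
    calc ∑ a ∈ Sfar, (m a : ℝ) * ‖(s - a)⁻¹ - (s₁ - a)⁻¹‖
        ≤ ∑ a ∈ Sfar, (m a : ℝ) * (Kc * ((s₁ - a)⁻¹).re) :=
          Finset.sum_le_sum fun a ha ↦ mul_le_mul_of_nonneg_left (hfar a ha) (Nat.cast_nonneg _)
      _ = Kc * ∑ a ∈ Sfar, (m a : ℝ) * ((s₁ - a)⁻¹).re := by
          rw [Finset.mul_sum]; exact Finset.sum_congr rfl fun a _ ↦ by ring
      _ ≤ Kc * ∑ a ∈ S, (m a : ℝ) * ((s₁ - a)⁻¹).re := by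
          refine mul_le_mul_of_nonneg_left ?_ hKc0
          exact Finset.sum_le_sum_of_subset_of_nonneg (by rw [hSfar]; exact Finset.filter_subset _ _)
            (fun a ha _ ↦ hterm_nn a ha)
      _ ≤ Kc * (U * ℒ) := mul_le_mul_of_nonneg_left hsum₁re hKc0
  -- (6) assemble
  have hsplit : ∑ a ∈ S, (m a : ℂ) / (s - a) =
      ∑ a ∈ S, (m a : ℂ) * ((s - a)⁻¹ - (s₁ - a)⁻¹) + ∑ a ∈ S, (m a : ℂ) / (s₁ - a) := by
    rw [← Finset.sum_add_distrib]
    exact Finset.sum_congr rfl fun a _ ↦ by ring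
  have hdiff_sum : ‖∑ a ∈ S, (m a : ℂ) * ((s - a)⁻¹ - (s₁ - a)⁻¹)‖ ≤
      Kc * (U * ℒ) + 13 * U * ℒ₀ ^ 2 * (1 / d + 10 * ℒ₀) := by
    calc ‖∑ a ∈ S, (m a : ℂ) * ((s - a)⁻¹ - (s₁ - a)⁻¹)‖
        ≤ ∑ a ∈ S, ‖(m a : ℂ) * ((s - a)⁻¹ - (s₁ - a)⁻¹)‖ := norm_sum_le _ _
      _ = ∑ a ∈ S, (m a : ℝ) * ‖(s - a)⁻¹ - (s₁ - a)⁻¹‖ :=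
          Finset.sum_congr rfl fun a _ ↦ by rw [norm_mul, Complex.norm_natCast]
      _ = ∑ a ∈ Sfar, (m a : ℝ) * ‖(s - a)⁻¹ - (s₁ - a)⁻¹‖ +
            ∑ a ∈ Snear, (m a : ℝ) * ‖(s - a)⁻¹ - (s₁ - a)⁻¹‖ := by
          rw [hSfar, hSnear]
          exact (Finset.sum_filter_add_sum_filter_not S _ _).symm
      _ ≤ Kc * (U * ℒ) + 13 * U * ℒ₀ ^ 2 * (1 / d + 10 * ℒ₀) := add_le_add hfar_sum hnear_sum
  have hEq : deriv χ.LFunction s / χ.LFunction s = ψ s + ∑ a ∈ S, (m a : ℂ) / (s - a) := by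
    rw [hψs]; ring
  have hψs_b := hψb s hscl
  rw [← hℒ] at hψs_b
  have hn1 := norm_add_le (ψ s)
    (∑ a ∈ S, (m a : ℂ) * ((s - a)⁻¹ - (s₁ - a)⁻¹) + ∑ a ∈ S, (m a : ℂ) / (s₁ - a))
  have hn2 := norm_add_le (∑ a ∈ S, (m a : ℂ) * ((s - a)⁻¹ - (s₁ - a)⁻¹))
    (∑ a ∈ S, (m a : ℂ) / (s₁ - a))
  rw [hEq, hsplit]
  have hfinalineq : E * ℒ + ((Kc * (U * ℒ) + 13 * U * ℒ₀ ^ 2 * (1 / d + 10 * ℒ₀)) + U * ℒ) =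
      (E + U + Kc * U) * ℒ + 13 * U * ℒ₀ ^ 2 * (1 / d + 10 * ℒ₀) := by ring
  linarith only [hn1, hn2, hψs_b, hdiff_sum, hsum₁, hfinalineq, htarget]

end Literature.NumberTheory.LFunctions.DirichletZFR
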